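import Summits.ABC.IUTFork.Cor312FrameVolumePiecesM
import Summits.ABC.IUTFork.Cor312SettingDHVol
import HarnessLib

/-!
# [IUTchIII] Corollary 3.12, statement — the `Cor312.Setting` over the M-LEVEL real log-shells `K_{v̲}`, `v̲ ∈ V̲`,
# with the PACKET-NORMALISED (probability-weighted) verbatim volumes: container, `hadm`, `hul_nonempty`, `BridgeHyps`

Record-only file (D-0012) of the abc-iut cell (seat abc-iut-w4-d013, gen 6; branch C «abc ⇐ S», C-lead ruling
C-R12 (e) «target #2′: the M-level (V̲, K_{v̲}) real volume setting»; unit P3 — with the container core of unit P2 —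
of abc-iut-w5-d166's `HOME/staging/w5/w5-d166/g4/G1-THETA-SHAPES.md`). TAKES NO SIDE on [IUTchIII] Cor. 3.12.

The READ binder `hΘ` of branch C's certificate (`Conditional/AbcOfSShrink2.lean`, one-sided Θ-side identification)
compares abc-iut-c312-7's `settingPrVolSharp` — built over the adic completions of the field `F` of the PILOT DATA at
ALL places of `F` — with abc-iut-S2's genuine number on the completions `K_{v̲}` at the SECTION places `v̲ ∈ V̲ ≅ V_mod`
of [IUTchI] Def. 3.1 (e) (kurims `paper:url-690e7b3c6199` p. 62; Dupuy–Hilado Def. 3.6.1 "`K_{v̲}`"): a cross-field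
inequality (abc-iut-S3 07:44:48Z, adopted as C-R12 (e)). The port re-instantiates the crew's real volume stack over
abc-iut-c312-5's M-LEVEL signature `Real.logShellsOfInitialDH D logvK` (`Thm311DHShells`; index skeleton
`Real.thetaIndexOfInitial D`, `Thm311RealM`). Unit P1 (abc-iut-w5-d166, `Cor312VolumesPadicSummandsM`, p433804) is the
`p`-adic presentation `padicPresentationOfInitialDH`; `Cor312FrameVolumePiecesM` (p434705) reads it at every finite
place of `ℚ` (`presAtM D hlog u`, `ratChar u`, the law `LogvAnalyticVal`) and supplies the field-factor pieces
`factorIdxM`/`factorFieldM`/`factorMapM`. THIS FILE is the twin, over those, of abc-iut-c312-1's `Thm311RealDegree`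
§2 (container) + `Thm311RealDegreeFull` §Consequences + `Cor312SettingPrVol` (p419741):

* §1 `localPiecesPrM` / **`summandPiecesPrM D hlog : SummandPieces (logShellsOfInitialDH D logvK)`** — the
  probability-weighted VERBATIM CONTAINER of [IUTchIII] Rmk. 3.1.1 (ii)(iii) (kurims `paper:url-4b091feeb646`
  pp. 94–96: direct product regions over the summands `v⃗`, normalised weighted log-volumes) on the GENUINE prime
  packets `K_{v̲_0} ⊗_{ℚ_p} ⋯ ⊗_{ℚ_p} K_{v̲_j}` (c312-1's generic `SummandPieces.ofLocal` of P1's `toLocalPieces`, trivial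
  at `∞` as at the F level), with its (Ind1)/(Ind2) generator facts `generatorsPreserve_summandPiecesPrM` (Dupuy–Hilado
  §4.7/§4.9) — the container core of the SHAPES unit P2 (the expectation identities / ideal boxes of
  `Thm311RealDegree` §3 remain unit P2's, abc-iut-w5-d244, on top of this file);
* §2 `situationPrVolM` (c312-5's `Situation.ofShells` with `Adm`/`logvol` := the container),
  `realizes_situationPrVolM`, `adm_and_logvol_eq_of_mem_indGroup_PrM` ([IUTchIII] proof of Cor. 3.12, Step (x),
  p. 181 l. 5–13: invariance along the whole (Ind1)/(Ind2) subgroup), `realPiecesPrM`, **`hadm_PrM`** (hull-sets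
  `λ·𝒪_L` pull back to admissible regions, [IUTchIII] Rmk. 3.9.5 (ii); c312-5's generic
  `PadicPresentation.adm_preimage_of_isHullSet` — admissibility does not read the weights);
* §3 **`settingPrVolM`** := c312-7's `Setting.ofComparison` (the setting of the printed statement of [IUTchIII]
  Cor. 3.12, p. 173 l. 41 – p. 174 l. 19) over `situationPrVolM` with generic Θ-box / `q`-centre binders,
  `settingPrVolM_n`, `hul_nonempty_settingPrVolM`, `bridgeHyps_PrM` (any setting over the situation) and
  `bridgeHyps_settingPrVolM` — c312-6's `BridgeHyps` with `mono`, `image_adm`, `image_fin`, `hul_nonempty`,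
  `theta_nonempty` DISCHARGED, leaving admissibility of the (Ind3)-enlarged Θ-region with finitely supported log-volume
  and `ThetaFinite` (units P4/P5: sharp boxes read off the genuine ideles, abc-iut-s2-p8 / abc-iut-s2-p9).

So every F-level theorem «at `settingPrVol`» has its M-level counterpart by `settingPrVol ↦ settingPrVolM`,
`bridgeHyps_settingPrVol ↦ bridgeHyps_settingPrVolM` (c312-7's `settingPrVolSharp` := `settingPrVol` with the sharp
boxes plugged — unit P4 does the same here). [claim: Mochizuki2012, status: disputed] for the quoted setting and
container; [cite: Mochizuki2012, IUTchI Def. 3.1 (e) p. 62]; [cite: DupuyHilado2025, §3.6, Def. 3.6.1, §4.7, §4.9].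
HONEST FRAMING: bookkeeping over OUR typed objects at the genuine carriers; no edit to c312-1's / c312-5's / c312-6's /
c312-7's or the lead's files; nothing here bears on the truth of [IUTchIII] Cor. 3.12; typed ≠ proved;
instantiated ≠ endorsed. Deliberately NOT here: the frame-volume twin (the lead's `frameVolumePiecesOfInitialDH` /
`settingOfFrameVolumes` route and the agreement of the two containers on hull-sets, c312-6's
`logvol_frameVolumePiecesPr_preimage_hullSet` pattern), the sharp pilot regions (P4), `ThetaFinite` / `hullDefined` (P5),
the comparison with abc-iut-S2's number (P6), any judgement.
-/

noncomputable section

open Set Function NumberField IsDedekindDomain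
open scoped Pointwise

namespace Summit.ABC.IUTFork.Thm311.Real

open Cor312 Cor312Vol Literature.IUT.LogThetaLattice Literature.IUT.LogVolume Literature.IUT.HodgeTheaters
  Literature.NumberTheory.NumberFields

variable {F K Fbar : Type} [Field F] [NumberField F] [Field K] [NumberField K] [Algebra F K]
  [Field Fbar] [Algebra F Fbar] [Algebra K Fbar] {E : WeierstrassCurve F} [E.IsElliptic] {l : ℕ}
  {Pb : BadPlacePredicates K} (D : InitialThetaData F K Fbar E l Pb)

/-! ## §1. The probability-weighted verbatim container of the M-level real log-shells (container core of unit P2) -/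

section Container

variable {logvK : PadicLogsVal K}

/-- The local pieces of the M-level signature at every rational place: P1's presentation at a finite place
(abc-iut-w5-d166's `presAtM`, p434705), the trivial container at `∞` (c312-5's Dupuy–Hilado convention,
`LocalPieces.trivial`; twin of c312-1's `localPiecesPr`). [claim: Mochizuki2012, status: disputed] -/
def localPiecesPrM (hlog : LogvAnalyticVal logvK) :
    ∀ vQ : (thetaIndexOfInitial D).VQ, LocalPieces (logShellsOfInitialDH D logvK) vQ
  | .inl _ => LocalPieces.trivial _ _
  | .inr u => (presAtM D hlog u).toLocalPieces

/-- **The verbatim container of the M-level real log-shells over all places, probability-weighted** (`Pr(v⃗) = Π_a n_{v_a}/[F_mod:ℚ]`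
read through `v̲ ↦ v̲ ∩ F_mod`, P1's `weightM`): the binders `Adm`, `logvol` of c312-5's `Situation.ofShells`, CONCRETE
([IUTchIII] Rmk. 3.1.1 (ii)(iii); twin of c312-1's `summandPiecesPr`). [claim: Mochizuki2012, status: disputed] -/
def summandPiecesPrM (hlog : LogvAnalyticVal logvK) : SummandPieces (logShellsOfInitialDH D logvK) :=
  SummandPieces.ofLocal (localPiecesPrM D hlog)

/-- **The generator hypotheses HOLD for the M-level container** (capsule permutations and Dupuy–Hilado's
(Ind2)-automorphisms preserve direct product regions and their weighted log-volumes, at every place; P1's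
`generatorsPreserveOfInitialDH` at the finite places). [cite: DupuyHilado2025, §4.7, §4.9] -/
theorem generatorsPreserve_summandPiecesPrM (hlog : LogvAnalyticVal logvK) :
    (summandPiecesPrM D hlog).GeneratorsPreserve :=
  SummandPieces.generatorsPreserve_ofLocal _ fun vQ =>
    match vQ with
    | .inl u => LocalPieces.generatorsPreserve_trivial (logShellsOfInitialDH D logvK) (.inl u)
    | .inr u => (presAtM D hlog u).generatorsPreserve_toLocalPieces

end Container

variable {logvK : PadicLogsVal K} (hlog : LogvAnalyticVal logvK)

/-! ## §2. The situation of Thm. 3.11 over the M-level log-shells with the packet-normalised verbatim volumes; `hadm` -/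

section Setting

variable (M : Type) [Field M] [NumberField M]
  (archPk : ∀ (j : (thetaIndexOfInitial D).Label) (vQ : (thetaIndexOfInitial D).VQ),
    Set ((logShellsOfInitialDH D logvK).Packet j vQ))
  (archSub : ∀ (j : (thetaIndexOfInitial D).Label) (v : (thetaIndexOfInitial D).V),
    Set ((logShellsOfInitialDH D logvK).Packet j ((thetaIndexOfInitial D).over v)))
  (Ψ : ℤ → ∀ v : (thetaIndexOfInitial D).V, v ∈ (thetaIndexOfInitial D).Vbad →
    Set ((logShellsOfInitialDH D logvK).StarPacket v))
  (act : ℤ → ∀ v : (thetaIndexOfInitial D).V, v ∈ (thetaIndexOfInitial D).Vbad →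
    (logShellsOfInitialDH D logvK).StarPacket v → Module.End ℚ ((logShellsOfInitialDH D logvK).StarPacket v))
  (Mmod : ℤ → ∀ j : (thetaIndexOfInitial D).LabelStar, Set ((logShellsOfInitialDH D logvK).GlobalPacket j.1))
  (region : ℤ → ∀ j : (thetaIndexOfInitial D).LabelStar, FinDivisor M → ∀ vQ : (thetaIndexOfInitial D).VQ,
    Set ((logShellsOfInitialDH D logvK).Packet j.1 vQ))

/-- **The situation of Thm. 3.11 over the M-level real Dupuy–Hilado log-shells WITH THE PACKET-NORMALISED VERBATIM
VOLUMES**: c312-5's `Situation.ofShells` with `Adm`, `logvol` := the probability-weighted container `summandPiecesPrM`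
(twin of c312-1's `situationPrVol`; remaining binders: archimedean integral structures, (b), (c) data).
[claim: Mochizuki2012, status: disputed] -/
abbrev situationPrVolM : Situation (thetaIndexOfInitial D) :=
  Situation.ofShells (logShellsOfInitialDH D logvK) M archPk archSub (summandPiecesPrM D hlog).Adm
    (summandPiecesPrM D hlog).logvol Ψ act Mmod region

/-- Every line of `situationPrVolM` carries the probability-weighted container. [folklore] -/
theorem realizes_situationPrVolM (n : ℤ) :
    (summandPiecesPrM D hlog).Realizes ((situationPrVolM D hlog M archPk archSub Ψ act Mmod region).D n) :=
  ⟨fun _ _ _ => Iff.rfl, fun _ _ _ => rfl⟩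

/-- **(Ind1)/(Ind2) INVARIANCE ALONG THE WHOLE INDETERMINACY SUBGROUP for the M-level probability-weighted
container**: every `Φ ∈ ⟨Ind1Family ∪ Ind2Family⟩` carries admissible regions to admissible regions of the same
log-volume ([IUTchIII] proof of Cor. 3.12, Step (x), p. 181 l. 5–13; twin of c312-1's
`adm_and_logvol_eq_of_mem_indGroup_Pr`). [claim: Mochizuki2012, status: disputed] -/
theorem adm_and_logvol_eq_of_mem_indGroup_PrM (n : ℤ) {Φ : (logShellsOfInitialDH D logvK).PacketAut}
    (hΦ : Φ ∈ Subgroup.closure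
      ((logShellsOfInitialDH D logvK).Ind1Family ∪ (logShellsOfInitialDH D logvK).Ind2Family))
    (j : (thetaIndexOfInitial D).Label) (vQ : (thetaIndexOfInitial D).VQ)
    (A : Set ((logShellsOfInitialDH D logvK).Packet j vQ))
    (hA : ((situationPrVolM D hlog M archPk archSub Ψ act Mmod region).D n).Adm j vQ A) :
    ((situationPrVolM D hlog M archPk archSub Ψ act Mmod region).D n).Adm j vQ (Φ j vQ '' A) ∧
      ((situationPrVolM D hlog M archPk archSub Ψ act Mmod region).D n).logvol j vQ (Φ j vQ '' A) =
        ((situationPrVolM D hlog M archPk archSub Ψ act Mmod region).D n).logvol j vQ A :=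
  SummandPieces.adm_and_logvol_eq_of_mem_indGroup
    (realizes_situationPrVolM D hlog M archPk archSub Ψ act Mmod region n)
    (generatorsPreserve_summandPiecesPrM D hlog) hΦ j vQ A hA

/-- **The M-level real field-factor pieces** of the setting over `situationPrVolM`: the factors, the comparison, and
the two pilot binders (Θ-boxes, `q`-centre) — twin of c312-1's `realPiecesPr`. [claim: Mochizuki2012, status: disputed] -/
def realPiecesPrM {ObLgp ObΔ : Type}
    (thetaBox : ℤ → ObLgp → ∀ (j : (thetaIndexOfInitial D).Label) (vQ : (thetaIndexOfInitial D).VQ),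
      Set (∀ s : factorIdxM D hlog j vQ, factorFieldM D hlog j vQ s))
    (qCentre : ObΔ → ∀ (j : (thetaIndexOfInitial D).Label) (vQ : (thetaIndexOfInitial D).VQ),
      ∀ s : factorIdxM D hlog j vQ, factorFieldM D hlog j vQ s) :
    Setting.RealPieces (situationPrVolM D hlog M archPk archSub Ψ act Mmod region) ObLgp ObΔ where
  J := factorIdxM D hlog
  instFintype := factorIdxM_fintype D hlog
  K := factorFieldM D hlog
  instField := factorFieldM_field D hlog
  instUltra := factorFieldM_ultra D hlog
  instProper := factorFieldM_proper D hlog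
  e := factorMapM D hlog
  thetaBox := thetaBox
  qCentre := qCentre

/-- **`hadm` DISCHARGED for the M-level packet-normalised volumes**: the preimage of every hull-set `λ·𝒪_L` of every
real packet is an admissible region of every line of `situationPrVolM` ([IUTchIII] Rmk. 3.9.5 (ii)
"`λ·𝒪 ∈ 𝕄(𝓘^ℚ(−))`"; at a finite rational place by c312-5's generic `PadicPresentation.adm_preimage_of_isHullSet` —
admissibility does not read the weights —, at `∞` trivially). [claim: Mochizuki2012, status: disputed] -/
theorem hadm_PrM (n : ℤ) : ∀ (j : (thetaIndexOfInitial D).Label) (vQ : (thetaIndexOfInitial D).VQ)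
    (H : Set (∀ s : factorIdxM D hlog j vQ, factorFieldM D hlog j vQ s)),
    IsHullSet (factorFieldM D hlog j vQ) H →
      ((situationPrVolM D hlog M archPk archSub Ψ act Mmod region).D n).Adm j vQ (factorMapM D hlog j vQ ⁻¹' H)
  | j, .inl u, H, hH => by
    refine (LocalPieces.adm_trivial_iff (logShellsOfInitialDH D logvK) (.inl u) j _).2 ⟨0, ?_⟩
    obtain ⟨c, -, rfl⟩ := hH
    show factorMapM D hlog j (.inl u) 0 ∈ hullSet _ c
    rw [hullSet, mem_polydisc]
    exact fun s => s.elim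
  | j, .inr u, _, hH => (presAtM D hlog u).adm_preimage_of_isHullSet j hH

variable (n : ℤ) {HT : Type} {LogLink : HT → HT → Type} {IsFull : ∀ {s t : HT}, LogLink s t → Prop}
  (lat : LGPGaussianLogThetaLattice LogLink IsFull)
  {Frd : Type} {IsoF : Frd → Frd → Type} {Ob : Frd → Type} {realify : Frd → Frd} {Strip : Type}
  {IsoS : Strip → Strip → Type}
  {Mv : ∀ v : (thetaIndexOfInitial D).V, v ∈ (thetaIndexOfInitial D).Vbad → Type} [∀ v h, Monoid (Mv v h)]
  (sig : GlobalLGPFrobenioidSignature (thetaIndexOfInitial D).lstar (thetaIndexOfInitial D).V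
    (· ∈ (thetaIndexOfInitial D).Vbad) Frd IsoF Ob realify Strip IsoS Mv)
  (split : SplittingMonoids Mv) {ObΔ : Type}
  {N : ∀ v : (thetaIndexOfInitial D).V, v ∈ (thetaIndexOfInitial D).Vbad → Type} [∀ v h, Monoid (N v h)]
  (qData : QPilotData ObΔ N)
  (thetaBox : ℤ → Ob sig.Clgp → ∀ (j : (thetaIndexOfInitial D).Label) (vQ : (thetaIndexOfInitial D).VQ),
    Set (∀ s : factorIdxM D hlog j vQ, factorFieldM D hlog j vQ s))
  (qCentre : ObΔ → ∀ (j : (thetaIndexOfInitial D).Label) (vQ : (thetaIndexOfInitial D).VQ),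
    ∀ s : factorIdxM D hlog j vQ, factorFieldM D hlog j vQ s)
  (hq : ∀ j vQ s, qCentre (qPilotObject qData) j vQ s ≠ 0)
  (hfin : ∀ j : (thetaIndexOfInitial D).Label, (Function.support fun vQ =>
    ((situationPrVolM D hlog M archPk archSub Ψ act Mmod region).D n).logvol j vQ
      (factorMapM D hlog j vQ ⁻¹' hullSet (factorFieldM D hlog j vQ) (qCentre (qPilotObject qData) j vQ))).Finite)

/-! ## §3. The setting, `hul_nonempty` and the `BridgeHyps` skeleton -/

/-- **The setting of [IUTchIII] Cor. 3.12 over the M-LEVEL real log-shells `K_{v̲}`, `v̲ ∈ V̲`, with the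
PACKET-NORMALISED verbatim volumes** (c312-7's `Setting.ofComparison` at `situationPrVolM` with the M-level real
field-factor pieces; `hadm` PROVED) — the twin of c312-1's `settingPrVol` over the genuine carriers of [IUTchI]
Def. 3.1 (e) / Dupuy–Hilado Def. 3.6.1. Binders left: the column `n`, the context data `lat`/`sig`/`split`/`qData`,
the Θ-boxes, the `q`-centre with `hq`, `hfin`, and the situation's archimedean integral structures and (b)(c) data.
[claim: Mochizuki2012, status: disputed] -/
def settingPrVolM : Cor312.Setting (situationPrVolM D hlog M archPk archSub Ψ act Mmod region) :=
  Setting.ofComparison n lat sig split qData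
    (realPiecesPrM D hlog M archPk archSub Ψ act Mmod region thetaBox qCentre)
    hq (hadm_PrM D hlog M archPk archSub Ψ act Mmod region n) hfin

/-- The column of the assembled setting is `n`. [folklore] -/
theorem settingPrVolM_n :
    (settingPrVolM D hlog M archPk archSub Ψ act Mmod region n lat sig split qData thetaBox qCentre hq hfin).n = n :=
  rfl

/-- **`hul_nonempty` DISCHARGED**: every hull-set of every frame of the assembled M-level setting is nonempty (it is an
admissible region of the container). [folklore] -/
theorem hul_nonempty_settingPrVolM (j : (thetaIndexOfInitial D).Label) (vQ : (thetaIndexOfInitial D).VQ) :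
    ∀ H ∈ ((settingPrVolM D hlog M archPk archSub Ψ act Mmod region n lat sig split qData thetaBox qCentre hq
      hfin).frame j vQ).Hul, H.Nonempty := by
  rintro _ ⟨H', hH', rfl⟩
  have h := hadm_PrM D hlog M archPk archSub Ψ act Mmod region n j vQ H' hH'
  exact SummandPieces.Adm.nonempty ((realizes_situationPrVolM D hlog M archPk archSub Ψ act Mmod region n).adm_iff
    j vQ _ |>.1 h)

/-- **c312-6's `BridgeHyps` for ANY c312-7 `Cor312.Setting` over the M-level probability-weighted real situation, with
`mono`, `image_adm`, `image_fin`, `theta_nonempty` DISCHARGED** (twin of c312-1's `bridgeHyps_Pr`): it remains to supply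
admissibility of the (Ind3)-enlarged Θ-region with finitely supported log-volume, non-empty hull-sets, and
`ThetaFinite`. [claim: Mochizuki2012, status: disputed] -/
theorem bridgeHyps_PrM (P : Cor312.Setting (situationPrVolM D hlog M archPk archSub Ψ act Mmod region))
    (hθ : ∀ (i : Fin (thetaIndexOfInitial D).lstar) (vQ : (thetaIndexOfInitial D).VQ),
      ((situationPrVolM D hlog M archPk archSub Ψ act Mmod region).D P.n).Adm _ vQ
        (P.thetaRegion3 (Cor312.Setting.labelSucc i) vQ))
    (hfinθ : ∀ i : Fin (thetaIndexOfInitial D).lstar, (Function.support fun vQ : (thetaIndexOfInitial D).VQ =>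
      ((situationPrVolM D hlog M archPk archSub Ψ act Mmod region).D P.n).logvol _ vQ
        (P.thetaRegion3 (Cor312.Setting.labelSucc i) vQ)).Finite)
    (hul_nonempty : ∀ (j : (thetaIndexOfInitial D).Label) (vQ : (thetaIndexOfInitial D).VQ),
      ∀ H ∈ (P.frame j vQ).Hul, H.Nonempty)
    (finite : P.ThetaFinite) : BridgeHyps P :=
  SummandPieces.bridgeHyps_of_summands (realizes_situationPrVolM D hlog M archPk archSub Ψ act Mmod region P.n)
    (generatorsPreserve_summandPiecesPrM D hlog) hθ hfinθ hul_nonempty finite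

/-- **c312-6's `BridgeHyps` for the M-level real setting with the packet-normalised verbatim volumes**, with `mono`,
`image_adm`, `image_fin`, `hul_nonempty`, `theta_nonempty` DISCHARGED (twin of c312-1's `bridgeHyps_settingPrVol`): it
remains to supply admissibility of the (Ind3)-enlarged Θ-region at the labels `j ∈ 𝔽_l^⋇` with finitely supported
log-volume, and `ThetaFinite` (units P4/P5 of the G1-Θ port). [claim: Mochizuki2012, status: disputed] -/
theorem bridgeHyps_settingPrVolM
    (hθ : ∀ (i : Fin (thetaIndexOfInitial D).lstar) (vQ : (thetaIndexOfInitial D).VQ),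
      ((situationPrVolM D hlog M archPk archSub Ψ act Mmod region).D n).Adm _ vQ
        ((settingPrVolM D hlog M archPk archSub Ψ act Mmod region n lat sig split qData thetaBox qCentre hq
          hfin).thetaRegion3 (Setting.labelSucc i) vQ))
    (hfinθ : ∀ i : Fin (thetaIndexOfInitial D).lstar, (Function.support fun vQ : (thetaIndexOfInitial D).VQ =>
      ((situationPrVolM D hlog M archPk archSub Ψ act Mmod region).D n).logvol _ vQ
        ((settingPrVolM D hlog M archPk archSub Ψ act Mmod region n lat sig split qData thetaBox qCentre hq
          hfin).thetaRegion3 (Setting.labelSucc i) vQ)).Finite)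
    (finite : (settingPrVolM D hlog M archPk archSub Ψ act Mmod region n lat sig split qData thetaBox qCentre hq
      hfin).ThetaFinite) :
    BridgeHyps (settingPrVolM D hlog M archPk archSub Ψ act Mmod region n lat sig split qData thetaBox qCentre hq
      hfin) :=
  bridgeHyps_PrM D hlog M archPk archSub Ψ act Mmod region _ hθ hfinθ
    (hul_nonempty_settingPrVolM D hlog M archPk archSub Ψ act Mmod region n lat sig split qData thetaBox qCentre hq
      hfin) finite

end Setting

end Summit.ABC.IUTFork.Thm311.Real

end
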